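/-
Copyright (c) 2026 the pub-hodgecm-mathlib formalisation cell (harness21).  Prover seat hodgecm-mathlib-K2E4-p11 (g2), Track B ∕ K2-LIT
(build stream 29), h413 = `stmt-HodgeConjecture-24833`, engine E2 line `K2_E2_ThetaExhaustionByRigidity`, unit CAPTURE, socket #20a
«ARCH-PAIR-HOLCOT» — helper (H2), part 1 of 2: the LINE frame-transport operator and the pointwise identity of theta lifts.  2026-09-04.
-/
import Literature.NumberTheory.Automorphic.Liu2021.ThetaLiftFromLineSeamFrameTransport      -- ★ (L-T2): `hω_of_T4` at the line, `rKron`, `aOfB`, `exists_gramTransporter`, §3 bridge; `normal_range_toAdelic_JW`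
import Literature.NumberTheory.Automorphic.Liu2021.Def411WeilCarriersFrameTransport         -- ★ `exists_omega_tmul_ratPointsThetaLiftCont_realDiagonal` (arch ⊗ fin factorisation of `ω(r_{L⁺}(h))`)
import Literature.NumberTheory.Automorphic.Liu2021.Def411WeilCarriersAtLineReindex          -- ★ `omega_chiSplitting_reindex` (re-enumeration `e ↦ e₁`), `piSBReindex_symm_trans_piSBReindex`
import HarnessLib

-- As in the lineage (★ `ThetaLiftFromLineSeamTransport` ∕ `…SeamFrameTransport`): the theta-kernel datum's types are very large; elaborate sequentially.
set_option Elab.async false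

/-!
# K2 ∕ E2 «ThetaExhaustionByRigidity», unit CAPTURE, socket #20a — (H2) part 1: the LINE FRAME-TRANSPORT OPERATOR and the POINTWISE identity of theta lifts

Cell `hodgecm-mathlib` (FLOOR 0), Track B «K2-LIT», engine E2, crux item H413 = `stmt-HodgeConjecture-24833` (route of record `HCCMUnconditional`, no route
verbs); helper of socket #20a `sig_K2E2CapArchPairHolCot` «ARCH-PAIR-HOLCOT» (deal K2E2-plan (g2) 2026-09-03T23:34:30Z, line lead K2E2-p12 (g2) «=» 23:51:16Z), consumed
by part 2 `Theorems/K2E2CapArchPairFrameTransport.lean` (`capArchPairHolCot_frameTransport`).  Author K2E4-p11 (g2).  `--supports stmt-HodgeConjecture-24833 --as helper`;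
THEOREMS ONLY (no `def`, no `instance`, no notation, no `sorry`); imports ★ only (no `Lines`).

* §1 `lineThetaLiftFun_eq_of_intertwiner` — the FUNCTION-LEVEL CORE of ★ `MeetsThetaLiftFromLine.transport` at `θ_W = id`: along a `Θ`-fixing linear `R`
  intertwining the `μ`-attached line pair representations at `(e₁′, d_V′)` and `(e₁, d_V)` over `(θ_V, id)`, the theta lifts against the SAME measure and weight
  on `[U(⟨a⟩)]` agree pointwise, `Θ̃′_Φ(f)(x) = Θ̃_{RΦ}(f)(θ_V x)` (★ `thetaKernelDatum_thetaFun_eq_of_intertwiner` under the integral sign).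
* §2 `exists_lineFrameTransportOperator` — for a rational isometry `B` (`formCongr c̄ B (1 • diag d_V′) = diag d_V`) and two enumerations `e`, `e₁` of `V ⊗ W`:
  a linear `R : 𝒮(𝔸^n) → 𝒮(𝔸^{n′})` that FIXES `Θ`, INTERTWINES `pairRep[e, d_V′] → pairRep[e₁, d_V]` over `(Ad(B⁻¹ ⊗ 1), id)` (★ `hω_of_T4` ∘ ★
  `conjSplitting_doubledWeilRep_comp_thetaD` at `e`, ★ `omega_chiSplitting_reindex` for `e ↦ e₁`), and is a PURE TENSOR operator `A ⊗ Q` on pure tensors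
  (★ `exists_omega_tmul_ratPointsThetaLiftCont_realDiagonal`).

HONEST LABEL.  HC_CM is proved only modulo the 7 printed citations (2 remaining named inputs: hLiu418 = stmt-HodgeConjecture-24832, h413 = stmt-HodgeConjecture-24833)
until rung 0 closes; count-neutral helper.

## References
* [Weil1964] A. Weil, *Sur certains groupes d'opérateurs unitaires*, Acta Math. 111 (1964), Chap. III n° 38–41, Thm. 6 p. 193.
* [GelbartRogawski1991] S. Gelbart, J. Rogawski, Invent. Math. 105 (1991), §3.1 Prop. 3.1.1 p. 455, Remark p. 457; §3.2 p. 457.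
* [Kudla1994] S. Kudla, Israel J. Math. 87 (1994), §2 (doubled space, Siegel parabolic), Thm. 3.1.
* [Liu2021] Y. Liu, Camb. J. Math. 9 (2021) = arXiv:2102.11518: Def. 4.11 (l. 2092–2096); App. D §D.1 Steps 1–2 (l. 5215–5219).
-/

set_option autoImplicit false
set_option linter.dupNamespace false

noncomputable section

namespace Summit.HodgeConjecture.HodgeConjecture.Cruxes.H413.K2E2CapLineFrameTransportOperator

open scoped TensorProduct Matrix Kronecker ComplexOrder ENNReal SchwartzMap Classical Pointwise
open NumberField NumberField.InfinitePlace NumberField.mixedEmbedding IsDedekindDomain MeasureTheory MulAction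
open Literature.NumberTheory Literature.NumberTheory.Automorphic Literature.NumberTheory.Automorphic.UnitaryGroup
open Literature.NumberTheory.Automorphic.UnitaryGroup.CotangentForms
open Literature.NumberTheory.Automorphic.Liu2021
open Literature.NumberTheory.Automorphic.Liu2021.Def411WeilCarriers
open Literature.NumberTheory.Automorphic.Liu2021.Def411WeilCarriersDoubling
open Literature.NumberTheory.Automorphic.IdeleClassGroup
open Literature.NumberTheory.GelbartRogawski1991 Literature.NumberTheory.GelbartRogawski1991.UnitaryDualPair
open Literature.NumberTheory.GelbartRogawski1991.UnitaryDualPair.WeilCoinv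
open Literature.NumberTheory.GelbartRogawski1991.GRConstruction
open Literature.NumberTheory.Weil1964
open Literature.RepresentationTheory Literature.RepresentationTheory.Liu2021
open Literature.RepresentationTheory.HeisenbergGroup

/-! ## §1 The function-level core of ★ `MeetsThetaLiftFromLine.transport` at `θ_W = id`: the theta LIFTS agree pointwise -/

section Pointwise

variable (L : Type) [Field L] [NumberField L] [IsCMField L] (N : ℕ)
  {n₁ n₂ : ℕ} (e₁' : Fin N × Fin 1 ≃ Fin n₁) (e₁ : Fin N × Fin 1 ≃ Fin n₂)
  (dV' : Fin N → L) (hdV' : ∀ i, IsCMField.complexConj L (dV' i) = dV' i) (hdV'0 : ∀ i, dV' i ≠ 0)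
  (dV : Fin N → L) (hdV : ∀ i, IsCMField.complexConj L (dV i) = dV i) (hdV0 : ∀ i, dV i ≠ 0)
  (μ : Literature.NumberTheory.Automorphic.IdeleClassGroup L →ₜ* Circle) (hμ : IsConjugateSymplectic L μ)
  (a : (↥(maximalRealSubfield L))ˣ)

/-- **THE THETA LIFTS OF TWO LINE DATA AGREE POINTWISE along a `Θ`-fixing intertwiner over `(θ_V, id)`** — the function-level core of ★
`MeetsThetaLiftFromLine.transport` when the `W`-side is untouched: for a homomorphism `θ_V : U(diag d_V′)(𝔸) →* U(diag d_V)(𝔸)` and a linear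
`R : 𝒮(𝔸^{n₁}) → 𝒮(𝔸^{n₂})` with `Θ ∘ R = Θ` and `R (ω′(s′_pair(k, u)) Φ) = ω(s_pair(θ_V k, u)) (R Φ)` (the two `μ`-attached line splittings at
`(e₁′, d_V′)`, `(e₁, d_V)`, the SAME line `⟨a⟩`), the theta lifts against the SAME measure `μ_W` and weight `f` on `[U(⟨a⟩)]` satisfy
`Θ̃′_Φ(f)(x) = Θ̃_{RΦ}(f)(θ_V x)` — the kernels agree termwise (★ `thetaKernelDatum_thetaFun_eq_of_intertwiner`), so the integrands agree.
[cite: Weil1964, Chap. III n° 41 Thm 6 p. 193] [cite: GelbartRogawski1991, §3.1 Remark p. 457; §3.2 p. 457] [cite: Liu2021, App. D §D.1 Step 1 (l. 5215)] -/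
theorem lineThetaLiftFun_eq_of_intertwiner
    (θV : ↥(UnitaryGroup.adelic (↥(maximalRealSubfield L)) L (IsCMField.complexConj L) N (Matrix.diagonal dV')) →*
      ↥(UnitaryGroup.adelic (↥(maximalRealSubfield L)) L (IsCMField.complexConj L) N (Matrix.diagonal dV)))
    (R : piSchwartzBruhat (↥(maximalRealSubfield L)) (Fin n₁) →ₗ[ℂ] piSchwartzBruhat (↥(maximalRealSubfield L)) (Fin n₂))
    (hΘ : ∀ Ψ : piSchwartzBruhat (↥(maximalRealSubfield L)) (Fin n₁),
      thetaDistLM (↥(maximalRealSubfield L)) (Fin n₂) (R Ψ) = thetaDistLM (↥(maximalRealSubfield L)) (Fin n₁) Ψ)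
    (hR : ∀ (k : ↥(UnitaryGroup.adelic (↥(maximalRealSubfield L)) L (IsCMField.complexConj L) N (Matrix.diagonal dV')))
      (u : ↥(UnitaryGroup.adelic (↥(maximalRealSubfield L)) L (IsCMField.complexConj L) 1 (JW (↥(maximalRealSubfield L)) L a)))
      (Φ : piSchwartzBruhat (↥(maximalRealSubfield L)) (Fin n₁)),
      R (pairRep (↥(maximalRealSubfield L)) L (IsCMField.complexConj L) N 1 e₁' (Matrix.diagonal dV') (JW (↥(maximalRealSubfield L)) L a)
          (chiSplittingLine L e₁' dV' hdV' hdV'0 (toHeckeCharacter L μ) (isUnitary_toHeckeCharacter L μ)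
            ((isOscillatorChar_toHeckeCharacter_iff μ).mpr hμ) (TW (↥(maximalRealSubfield L)) a)
            (isUnit_det_TW (↥(maximalRealSubfield L)) a) (JW (↥(maximalRealSubfield L)) L a) (JW_eq (↥(maximalRealSubfield L)) L a))
          (k, u) Φ) =
        pairRep (↥(maximalRealSubfield L)) L (IsCMField.complexConj L) N 1 e₁ (Matrix.diagonal dV) (JW (↥(maximalRealSubfield L)) L a)
          (chiSplittingLine L e₁ dV hdV hdV0 (toHeckeCharacter L μ) (isUnitary_toHeckeCharacter L μ)
            ((isOscillatorChar_toHeckeCharacter_iff μ).mpr hμ) (TW (↥(maximalRealSubfield L)) a)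
            (isUnit_det_TW (↥(maximalRealSubfield L)) a) (JW (↥(maximalRealSubfield L)) L a) (JW_eq (↥(maximalRealSubfield L)) L a))
          (θV k, u) (R Φ))
    (hρ' : HasThetaMajorants fun
      (p : ↥(UnitaryGroup.adelic (↥(maximalRealSubfield L)) L (IsCMField.complexConj L) N (Matrix.diagonal dV')) ×
        ↥(UnitaryGroup.adelic (↥(maximalRealSubfield L)) L (IsCMField.complexConj L) 1 (JW (↥(maximalRealSubfield L)) L a)))
      (Φ : piSchwartzBruhat (↥(maximalRealSubfield L)) (Fin n₁)) =>
        pairRep (↥(maximalRealSubfield L)) L (IsCMField.complexConj L) N 1 e₁' (Matrix.diagonal dV') (JW (↥(maximalRealSubfield L)) L a)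
          (chiSplittingLine L e₁' dV' hdV' hdV'0 (toHeckeCharacter L μ) (isUnitary_toHeckeCharacter L μ)
            ((isOscillatorChar_toHeckeCharacter_iff μ).mpr hμ) (TW (↥(maximalRealSubfield L)) a)
            (isUnit_det_TW (↥(maximalRealSubfield L)) a) (JW (↥(maximalRealSubfield L)) L a) (JW_eq (↥(maximalRealSubfield L)) L a))
          p Φ)
    (hρ : HasThetaMajorants fun
      (p : ↥(UnitaryGroup.adelic (↥(maximalRealSubfield L)) L (IsCMField.complexConj L) N (Matrix.diagonal dV)) ×
        ↥(UnitaryGroup.adelic (↥(maximalRealSubfield L)) L (IsCMField.complexConj L) 1 (JW (↥(maximalRealSubfield L)) L a)))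
      (Φ : piSchwartzBruhat (↥(maximalRealSubfield L)) (Fin n₂)) =>
        pairRep (↥(maximalRealSubfield L)) L (IsCMField.complexConj L) N 1 e₁ (Matrix.diagonal dV) (JW (↥(maximalRealSubfield L)) L a)
          (chiSplittingLine L e₁ dV hdV hdV0 (toHeckeCharacter L μ) (isUnitary_toHeckeCharacter L μ)
            ((isOscillatorChar_toHeckeCharacter_iff μ).mpr hμ) (TW (↥(maximalRealSubfield L)) a)
            (isUnit_det_TW (↥(maximalRealSubfield L)) a) (JW (↥(maximalRealSubfield L)) L a) (JW_eq (↥(maximalRealSubfield L)) L a))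
          p Φ)
    [CompactSpace (↥(UnitaryGroup.adelic (↥(maximalRealSubfield L)) L (IsCMField.complexConj L) N (Matrix.diagonal dV')) ⧸
      (UnitaryGroup.toAdelic (↥(maximalRealSubfield L)) L (IsCMField.complexConj L) N (Matrix.diagonal dV')).range)]
    [CompactSpace (↥(UnitaryGroup.adelic (↥(maximalRealSubfield L)) L (IsCMField.complexConj L) N (Matrix.diagonal dV)) ⧸
      (UnitaryGroup.toAdelic (↥(maximalRealSubfield L)) L (IsCMField.complexConj L) N (Matrix.diagonal dV)).range)]
    [MeasurableSpace (↥(UnitaryGroup.adelic (↥(maximalRealSubfield L)) L (IsCMField.complexConj L) 1 (JW (↥(maximalRealSubfield L)) L a)) ⧸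
      (UnitaryGroup.toAdelic (↥(maximalRealSubfield L)) L (IsCMField.complexConj L) 1 (JW (↥(maximalRealSubfield L)) L a)).range)]
    [BorelSpace (↥(UnitaryGroup.adelic (↥(maximalRealSubfield L)) L (IsCMField.complexConj L) 1 (JW (↥(maximalRealSubfield L)) L a)) ⧸
      (UnitaryGroup.toAdelic (↥(maximalRealSubfield L)) L (IsCMField.complexConj L) 1 (JW (↥(maximalRealSubfield L)) L a)).range)]
    (μW : Measure (↥(UnitaryGroup.adelic (↥(maximalRealSubfield L)) L (IsCMField.complexConj L) 1 (JW (↥(maximalRealSubfield L)) L a)) ⧸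
      (UnitaryGroup.toAdelic (↥(maximalRealSubfield L)) L (IsCMField.complexConj L) 1 (JW (↥(maximalRealSubfield L)) L a)).range))
    [IsFiniteMeasure μW]
    (f : haveI := normal_range_toAdelic_JW L a
      C(↥(UnitaryGroup.adelic (↥(maximalRealSubfield L)) L (IsCMField.complexConj L) 1 (JW (↥(maximalRealSubfield L)) L a)) ⧸
        (UnitaryGroup.toAdelic (↥(maximalRealSubfield L)) L (IsCMField.complexConj L) 1 (JW (↥(maximalRealSubfield L)) L a)).range, ℂ))
    (Φ : piSchwartzBruhat (↥(maximalRealSubfield L)) (Fin n₁))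
    (x : ↥(UnitaryGroup.adelic (↥(maximalRealSubfield L)) L (IsCMField.complexConj L) N (Matrix.diagonal dV'))) :
    haveI := normal_range_toAdelic_JW L a
    (lineThetaKernelDatum L N e₁' dV' hdV' hdV'0 μ hμ a hρ').thetaLiftFun μW Φ f x =
      (lineThetaKernelDatum L N e₁ dV hdV hdV0 μ hμ a hρ).thetaLiftFun μW (R Φ) f (θV x) := by
  haveI hN := normal_range_toAdelic_JW L a
  haveI hcW := compactSpace_quotient_range_toAdelic_JW L a
  rw [ThetaKernelDatum.thetaLiftFun_apply, ThetaKernelDatum.thetaLiftFun_apply, ThetaKernelDatum.thetaLift_apply,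
    ThetaKernelDatum.thetaLift_apply]
  refine integral_congr_ae (Filter.Eventually.of_forall fun q => ?_)
  induction q using QuotientGroup.induction_on with
  | H u =>
    have hx : θV x⁻¹ = (θV x)⁻¹ := map_inv θV x
    beta_reduce
    rw [ThetaKernelDatum.thetaKer_mk, ThetaKernelDatum.thetaKer_mk, ← ThetaKernelDatum.thetaFun_apply,
      ← ThetaKernelDatum.thetaFun_apply, ← hx,
      thetaKernelDatum_thetaFun_eq_of_intertwiner θV (MonoidHom.id _) R hΘ hR Φ x⁻¹ u]
    rfl

end Pointwise

/-! ## §2 The frame-transport OPERATOR: Weil's Θ-fixing lift of a rational isometry of `V`, re-enumerated, and its factorisation on pure tensors -/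

section Operator

variable (L : Type) [Field L] [NumberField L] [IsCMField L] {N n n' : ℕ}
  (e : Fin N × Fin 1 ≃ Fin n) (e₁ : Fin N × Fin 1 ≃ Fin n')
  (dV' : Fin N → L) (hdV' : ∀ i, IsCMField.complexConj L (dV' i) = dV' i) (hdV'0 : ∀ i, dV' i ≠ 0)
  (dV : Fin N → L) (hdV : ∀ i, IsCMField.complexConj L (dV i) = dV i) (hdV0 : ∀ i, dV i ≠ 0)
  (B : GL (Fin N) L)
  (hB : formCongr ((IsCMField.complexConj L : L ≃ₐ[Fp L] L) : L →+* L) B ((1 : L) • Matrix.diagonal dV') = Matrix.diagonal dV)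
  (μ : Literature.NumberTheory.Automorphic.IdeleClassGroup L →ₜ* Circle) (hμ : IsConjugateSymplectic L μ)
  (a : (↥(maximalRealSubfield L))ˣ)

set_option maxHeartbeats 8000000 in -- measured: 1 600 000 fails (the line telescopes at two enumerations are compared in `isDefEq` when the witnesses are assembled)
/-- **THE FRAME-TRANSPORT OPERATOR of a rational isometry `B : (V, diag d_V) ≅ (V, diag d_V′)`** (`formCongr c̄ B (1 • diag d_V′) = diag d_V`), between
the models `𝒮(𝔸^n)` (enumeration `e`) and `𝒮(𝔸^{n′})` (enumeration `e₁`) of the pair `U(diag d_V⁽′⁾) × U(⟨a⟩)` at the `μ`-attached line splittings: a linear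
`R = R_{e⁻¹e₁} ∘ R_e ∘ ω(r_Kron) ∘ R_e⁻¹` — `r_Kron = r_{L⁺}(h₀)` Weil's Θ-FIXING rational lift of the see-saw element of `B⁻¹ ⊗ 1` (★ `rKron`) — which
(i) FIXES the theta distribution (★ `thetaDist_omega_ratPointsThetaLiftCont`, ★ `thetaDistLM_piSBReindex`), (ii) INTERTWINES `pairRep[e, d_V′] → pairRep[e₁, d_V]` over
`(Ad(B⁻¹ ⊗ 1), id)` — at the enumeration `e` this is ★ `hω_of_T4` fed with the HYPOTHESIS-FREE doubled isometry transport ★ `conjSplitting_doubledWeilRep_comp_thetaD`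
([Kudla1994, Thm. 3.1]) and read at the line through ★ `omega_pairSplitting_chiSplittingLine` (the operator block of ★ `MeetsThetaLiftFromLine.frameTransport` token for
token), the re-enumeration `e ↦ e₁` being ★ `omega_chiSplitting_reindex` —, and (iii) is a PURE TENSOR OPERATOR on pure tensors, `R (R_e(φ ⊗ Φ_f)) = R_{e₁}(Aφ ⊗ QΦ_f)`
for a continuous linear automorphism `A` of `𝓢((L⁺ ⊗ ℝ)^{N×1})` and a linear automorphism `Q` of `𝒮((𝔸_{L⁺,f})^{N×1})` (★ `exists_omega_tmul_ratPointsThetaLiftCont_realDiagonal`,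
★ `piSBReindex_tmul`).
[cite: Weil1964, Chap. III n° 38–41, Thm 6 p. 193] [cite: GelbartRogawski1991, §3.1 Prop. 3.1.1 p. 455, Remark p. 457] [cite: Kudla1994, §2, Thm. 3.1]
[cite: Liu2021, Def. 4.11 (l. 2092–2096); App. D §D.1 Steps 1–2 (l. 5215–5219)] -/
theorem exists_lineFrameTransportOperator :
    ∃ (R : piSchwartzBruhat (Fp L) (Fin n) →ₗ[ℂ] piSchwartzBruhat (Fp L) (Fin n'))
      (A : 𝓢(((Fin N × Fin 1) → mixedSpace (Fp L)), ℂ) ≃L[ℂ] 𝓢(((Fin N × Fin 1) → mixedSpace (Fp L)), ℂ))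
      (Q : FinSB (Fp L) (Fin N × Fin 1) ≃ₗ[ℂ] FinSB (Fp L) (Fin N × Fin 1)),
      (∀ Ψ : piSchwartzBruhat (Fp L) (Fin n), thetaDistLM (Fp L) (Fin n') (R Ψ) = thetaDistLM (Fp L) (Fin n) Ψ) ∧
      (∀ (k : ↥(UnitaryGroup.adelic (Fp L) L (IsCMField.complexConj L) N (Matrix.diagonal dV'))) (u : ↥(UnitaryGroup.adelic (Fp L) L (IsCMField.complexConj L) 1 (JW (Fp L) L a))) (Φ : piSchwartzBruhat (Fp L) (Fin n)),
        R (pairRep (Fp L) L (IsCMField.complexConj L) N 1 e (Matrix.diagonal dV') (JW (Fp L) L a) (chiSplittingLine L e dV' hdV' hdV'0 (toHeckeCharacter L μ) (isUnitary_toHeckeCharacter L μ) ((isOscillatorChar_toHeckeCharacter_iff μ).mpr hμ) (TW (Fp L) a) (isUnit_det_TW (Fp L) a) (JW (Fp L) L a) (JW_eq (Fp L) L a)) (k, u) Φ) = pairRep (Fp L) L (IsCMField.complexConj L) N 1 e₁ (Matrix.diagonal dV) (JW (Fp L) L a) (chiSplittingLine L e₁ dV hdV hdV0 (toHeckeCharacter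 L μ) (isUnitary_toHeckeCharacter L μ) ((isOscillatorChar_toHeckeCharacter_iff μ).mpr hμ) (TW (Fp L) a) (isUnit_det_TW (Fp L) a) (JW (Fp L) L a) (JW_eq (Fp L) L a)) ((adelicIsometryConj (Fp L) L (IsCMField.complexConj L) N (aOfB L B) (aOfB_isometry L dV dV' B hB)) k, u) (R Φ)) ∧
      (∀ (φ : 𝓢(((Fin N × Fin 1) → mixedSpace (Fp L)), ℂ)) (f : FinSB (Fp L) (Fin N × Fin 1)),
        R (piSBReindex (Fp L) e (piSchwartzBruhatEquiv (Fp L) (Fin N × Fin 1) (φ ⊗ₜ[ℂ] f))) =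
          piSBReindex (Fp L) e₁ (piSchwartzBruhatEquiv (Fp L) (Fin N × Fin 1) (A φ ⊗ₜ[ℂ] Q f))) := by
  classical
  /- the operator `R_e := R_e ∘ ω(r_Kron) ∘ R_e⁻¹` at the source enumeration (★ `MeetsThetaLiftFromLine.frameTransport`'s block) -/
  obtain ⟨C₀, C, hCC₀, hC⟩ := exists_gramTransporter L dV hdV hdV0 dV' hdV' hdV'0 (lineW L (TW (Fp L) a)) (complexConj_lineW L (TW (Fp L) a)) (lineW_ne_zero L (TW (Fp L) a) (isUnit_det_TW (Fp L) a))
  have hω := hω_of_T4 L e dV hdV hdV0 dV' hdV' hdV'0 (lineW L (TW (Fp L) a)) (complexConj_lineW L (TW (Fp L) a)) (lineW_ne_zero L (TW (Fp L) a) (isUnit_det_TW (Fp L) a)) B hB hCC₀ hC (toHeckeCharacter L μ) (isUnitary_toHeckeCharacter L μ) ((isOscillatorChar_toHeckeCharacter_iff μ).mpr hμ)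
    (conjSplitting_doubledWeilRep_comp_thetaD L e dV hdV hdV0 dV' hdV' hdV'0 (lineW L (TW (Fp L) a)) (complexConj_lineW L (TW (Fp L) a)) (lineW_ne_zero L (TW (Fp L) a) (isUnit_det_TW (Fp L) a)) hCC₀ hC B hB (toHeckeCharacter L μ) (isUnitary_toHeckeCharacter L μ) ((isOscillatorChar_toHeckeCharacter_iff μ).mpr hμ))
  let Re : piSchwartzBruhat (Fp L) (Fin n) →ₗ[ℂ] piSchwartzBruhat (Fp L) (Fin n) :=
    (piSBReindex (Fp L) e).toLinearMap ∘ₗ (adelicMpCont.omega (Fp L) (Fin N × Fin 1) _ (rKron L dV hdV hdV0 dV' hdV' (lineW L (TW (Fp L) a)) (complexConj_lineW L (TW (Fp L) a)) (lineW_ne_zero L (TW (Fp L) a) (isUnit_det_TW (Fp L) a)) (coe_aOfB L B) (aOfB_isometry L dV dV' B hB) hCC₀ hC)) ∘ₗ (piSBReindex (Fp L) e).symm.toLinearMap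
  have hReapp : ∀ Φ, Re Φ = piSBReindex (Fp L) e (adelicMpCont.omega (Fp L) (Fin N × Fin 1) _ (rKron L dV hdV hdV0 dV' hdV' (lineW L (TW (Fp L) a)) (complexConj_lineW L (TW (Fp L) a)) (lineW_ne_zero L (TW (Fp L) a) (isUnit_det_TW (Fp L) a)) (coe_aOfB L B) (aOfB_isometry L dV dV' B hB) hCC₀ hC) ((piSBReindex (Fp L) e).symm Φ)) :=
    fun _ => rfl
  have hΘe : ∀ Ψ : piSchwartzBruhat (Fp L) (Fin n), thetaDistLM (Fp L) (Fin n) (Re Ψ) = thetaDistLM (Fp L) (Fin n) Ψ := fun Ψ => by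
    have hfix : thetaDist (Fp L) (Fin N × Fin 1)
        ((adelicMpCont.omega (Fp L) (Fin N × Fin 1) _ (rKron L dV hdV hdV0 dV' hdV' (lineW L (TW (Fp L) a)) (complexConj_lineW L (TW (Fp L) a)) (lineW_ne_zero L (TW (Fp L) a) (isUnit_det_TW (Fp L) a)) (coe_aOfB L B) (aOfB_isometry L dV dV' B hB) hCC₀ hC) ((piSBReindex (Fp L) e).symm Ψ) : piSchwartzBruhat (Fp L) (Fin N × Fin 1)) :
          ((Fin N × Fin 1) → AdeleRing (𝓞 (Fp L)) (Fp L)) → ℂ) =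
        thetaDist (Fp L) (Fin N × Fin 1) (((piSBReindex (Fp L) e).symm Ψ : piSchwartzBruhat (Fp L) (Fin N × Fin 1)) :
          ((Fin N × Fin 1) → AdeleRing (𝓞 (Fp L)) (Fp L)) → ℂ) :=
      thetaDist_omega_ratPointsThetaLiftCont (Fp L) (Fin N × Fin 1) _ _ _ _
    rw [hReapp, thetaDistLM_piSBReindex, thetaDistLM_apply, hfix, ← thetaDistLM_apply, piSBReindex_symm, thetaDistLM_piSBReindex]
  have hRe : ∀ (k : ↥(UnitaryGroup.adelic (Fp L) L (IsCMField.complexConj L) N (Matrix.diagonal dV'))) (u : ↥(UnitaryGroup.adelic (Fp L) L (IsCMField.complexConj L) 1 (JW (Fp L) L a))) (Φ : piSchwartzBruhat (Fp L) (Fin n)),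
      Re (pairRep (Fp L) L (IsCMField.complexConj L) N 1 e (Matrix.diagonal dV') (JW (Fp L) L a) (chiSplittingLine L e dV' hdV' hdV'0 (toHeckeCharacter L μ) (isUnitary_toHeckeCharacter L μ) ((isOscillatorChar_toHeckeCharacter_iff μ).mpr hμ) (TW (Fp L) a) (isUnit_det_TW (Fp L) a) (JW (Fp L) L a) (JW_eq (Fp L) L a)) (k, u) Φ) = pairRep (Fp L) L (IsCMField.complexConj L) N 1 e (Matrix.diagonal dV) (JW (Fp L) L a) (chiSplittingLine L e dV hdV hdV0 (toHeckeCharacter L μ) (isUnitary_toHeckeCharacter L μ) ((isOscillatorChar_toHeckeCharacter_iff μ).mpr hμ) (TW (Fp L) a) (isUnit_det_TW (Fp L) a) (JW (Fp L) L a) (JW_eq (Fp L) L a)) ((adelicIsometryConj (Fp L) L (IsCMField.complexConj L) N (aOfB L B) (aOfB_isometry L dV dV' B hB)) k, u) (Re Φ) := fun k u Φ => by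
    have h1 := omega_pairSplitting_chiSplittingLine L e dV' hdV' hdV'0 (toHeckeCharacter L μ) (isUnitary_toHeckeCharacter L μ) ((isOscillatorChar_toHeckeCharacter_iff μ).mpr hμ) (TW (Fp L) a) (isUnit_det_TW (Fp L) a) (JW (Fp L) L a) (JW_eq (Fp L) L a) k u Φ
    have h2 := omega_pairSplitting_chiSplittingLine L e dV hdV hdV0 (toHeckeCharacter L μ) (isUnitary_toHeckeCharacter L μ) ((isOscillatorChar_toHeckeCharacter_iff μ).mpr hμ) (TW (Fp L) a) (isUnit_det_TW (Fp L) a) (JW (Fp L) L a) (JW_eq (Fp L) L a) ((adelicIsometryConj (Fp L) L (IsCMField.complexConj L) N (aOfB L B) (aOfB_isometry L dV dV' B hB)) k) u (Re Φ)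
    have h3 := hω (adelicInl (Fp L) L (IsCMField.complexConj L) N 1 (Matrix.diagonal dV') (Matrix.diagonal (lineW L (TW (Fp L) a))) k *
      adelicInr (Fp L) L (IsCMField.complexConj L) N 1 (Matrix.diagonal dV') (Matrix.diagonal (lineW L (TW (Fp L) a))) ((MulEquiv.subgroupCongr (congrArg (UnitaryGroup.adelic (Fp L) L (IsCMField.complexConj L) 1) (diagonal_lineW L (TW (Fp L) a) (JW_eq (Fp L) L a)))).symm u)) ((piSBReindex (Fp L) e).symm Φ)
    have hΦ : (piSBReindex (Fp L) e) ((piSBReindex (Fp L) e).symm Φ) = Φ := LinearEquiv.apply_symm_apply _ _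
    have hconj : adelicPairIsometryConjLeft (Fp L) L (IsCMField.complexConj L) N 1 (aOfB L B) (aOfB_isometry L dV dV' B hB)
        (adelicInl (Fp L) L (IsCMField.complexConj L) N 1 (Matrix.diagonal dV') (Matrix.diagonal (lineW L (TW (Fp L) a))) k *
          adelicInr (Fp L) L (IsCMField.complexConj L) N 1 (Matrix.diagonal dV') (Matrix.diagonal (lineW L (TW (Fp L) a))) ((MulEquiv.subgroupCongr (congrArg (UnitaryGroup.adelic (Fp L) L (IsCMField.complexConj L) 1) (diagonal_lineW L (TW (Fp L) a) (JW_eq (Fp L) L a)))).symm u)) =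
        adelicInl (Fp L) L (IsCMField.complexConj L) N 1 (Matrix.diagonal dV) (Matrix.diagonal (lineW L (TW (Fp L) a))) ((adelicIsometryConj (Fp L) L (IsCMField.complexConj L) N (aOfB L B) (aOfB_isometry L dV dV' B hB)) k) *
          adelicInr (Fp L) L (IsCMField.complexConj L) N 1 (Matrix.diagonal dV) (Matrix.diagonal (lineW L (TW (Fp L) a))) ((MulEquiv.subgroupCongr (congrArg (UnitaryGroup.adelic (Fp L) L (IsCMField.complexConj L) 1) (diagonal_lineW L (TW (Fp L) a) (JW_eq (Fp L) L a)))).symm u) := by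
      rw [map_mul, adelicPairIsometryConjLeft_adelicInl, adelicPairIsometryConjLeft_adelicInr]
    simp only [hΦ, hconj] at h3
    have hA := (pairRep_apply (Fp L) L (IsCMField.complexConj L) N 1 e (Matrix.diagonal dV') (JW (Fp L) L a) (chiSplittingLine L e dV' hdV' hdV'0 (toHeckeCharacter L μ) (isUnitary_toHeckeCharacter L μ) ((isOscillatorChar_toHeckeCharacter_iff μ).mpr hμ) (TW (Fp L) a) (isUnit_det_TW (Fp L) a) (JW (Fp L) L a) (JW_eq (Fp L) L a)) (k, u) Φ).trans h1
    simp only [pairSplitting_apply] at hA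
    have hB' := (pairRep_apply (Fp L) L (IsCMField.complexConj L) N 1 e (Matrix.diagonal dV) (JW (Fp L) L a) (chiSplittingLine L e dV hdV hdV0 (toHeckeCharacter L μ) (isUnitary_toHeckeCharacter L μ) ((isOscillatorChar_toHeckeCharacter_iff μ).mpr hμ) (TW (Fp L) a) (isUnit_det_TW (Fp L) a) (JW (Fp L) L a) (JW_eq (Fp L) L a)) ((adelicIsometryConj (Fp L) L (IsCMField.complexConj L) N (aOfB L B) (aOfB_isometry L dV dV' B hB)) k, u) (Re Φ)).trans h2
    simp only [pairSplitting_apply] at hB'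
    simp only [hB']
    simp only [hA, hReapp, h3, LinearEquiv.apply_symm_apply]
  /- re-enumeration `e ↦ e₁` (★ `omega_chiSplitting_reindex`) and the total operator `R := R_{e⁻¹e₁} ∘ R_e` -/
  have hR₂ : ∀ (k : ↥(UnitaryGroup.adelic (Fp L) L (IsCMField.complexConj L) N (Matrix.diagonal dV))) (u : ↥(UnitaryGroup.adelic (Fp L) L (IsCMField.complexConj L) 1 (JW (Fp L) L a))) (Ψ : piSchwartzBruhat (Fp L) (Fin n)),
      piSBReindex (Fp L) (e.symm.trans e₁) (pairRep (Fp L) L (IsCMField.complexConj L) N 1 e (Matrix.diagonal dV) (JW (Fp L) L a) (chiSplittingLine L e dV hdV hdV0 (toHeckeCharacter L μ) (isUnitary_toHeckeCharacter L μ) ((isOscillatorChar_toHeckeCharacter_iff μ).mpr hμ) (TW (Fp L) a) (isUnit_det_TW (Fp L) a) (JW (Fp L) L a) (JW_eq (Fp L) L a)) (k, u) Ψ) =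
        pairRep (Fp L) L (IsCMField.complexConj L) N 1 e₁ (Matrix.diagonal dV) (JW (Fp L) L a) (chiSplittingLine L e₁ dV hdV hdV0 (toHeckeCharacter L μ) (isUnitary_toHeckeCharacter L μ) ((isOscillatorChar_toHeckeCharacter_iff μ).mpr hμ) (TW (Fp L) a) (isUnit_det_TW (Fp L) a) (JW (Fp L) L a) (JW_eq (Fp L) L a)) (k, u) (piSBReindex (Fp L) (e.symm.trans e₁) Ψ) := fun k u Ψ => by
    have hA := (pairRep_apply (Fp L) L (IsCMField.complexConj L) N 1 e (Matrix.diagonal dV) (JW (Fp L) L a) (chiSplittingLine L e dV hdV hdV0 (toHeckeCharacter L μ) (isUnitary_toHeckeCharacter L μ) ((isOscillatorChar_toHeckeCharacter_iff μ).mpr hμ) (TW (Fp L) a) (isUnit_det_TW (Fp L) a) (JW (Fp L) L a) (JW_eq (Fp L) L a)) (k, u) Ψ).trans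
      (omega_pairSplitting_chiSplittingLine L e dV hdV hdV0 (toHeckeCharacter L μ) (isUnitary_toHeckeCharacter L μ) ((isOscillatorChar_toHeckeCharacter_iff μ).mpr hμ) (TW (Fp L) a) (isUnit_det_TW (Fp L) a) (JW (Fp L) L a) (JW_eq (Fp L) L a) k u Ψ)
    have hB' := (pairRep_apply (Fp L) L (IsCMField.complexConj L) N 1 e₁ (Matrix.diagonal dV) (JW (Fp L) L a) (chiSplittingLine L e₁ dV hdV hdV0 (toHeckeCharacter L μ) (isUnitary_toHeckeCharacter L μ) ((isOscillatorChar_toHeckeCharacter_iff μ).mpr hμ) (TW (Fp L) a) (isUnit_det_TW (Fp L) a) (JW (Fp L) L a) (JW_eq (Fp L) L a)) (k, u)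
      (piSBReindex (Fp L) (e.symm.trans e₁) Ψ)).trans
      (omega_pairSplitting_chiSplittingLine L e₁ dV hdV hdV0 (toHeckeCharacter L μ) (isUnitary_toHeckeCharacter L μ) ((isOscillatorChar_toHeckeCharacter_iff μ).mpr hμ) (TW (Fp L) a) (isUnit_det_TW (Fp L) a) (JW (Fp L) L a) (JW_eq (Fp L) L a) k u
        (piSBReindex (Fp L) (e.symm.trans e₁) Ψ))
    simp only [pairSplitting_apply] at hA hB'
    rw [hA, hB']
    exact (omega_chiSplitting_reindex L e₁ e dV hdV hdV0 (lineW L (TW (Fp L) a)) (complexConj_lineW L (TW (Fp L) a)) (lineW_ne_zero L (TW (Fp L) a) (isUnit_det_TW (Fp L) a)) (toHeckeCharacter L μ) (isUnitary_toHeckeCharacter L μ) ((isOscillatorChar_toHeckeCharacter_iff μ).mpr hμ) _ Ψ).symm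
  -- `ω(r_Kron)` is a pure tensor operator on pure tensors
  obtain ⟨A, Q, hAQ⟩ : ∃ (A : 𝓢(((Fin N × Fin 1) → mixedSpace (Fp L)), ℂ) ≃L[ℂ] 𝓢(((Fin N × Fin 1) → mixedSpace (Fp L)), ℂ))
      (Q : FinSB (Fp L) (Fin N × Fin 1) ≃ₗ[ℂ] FinSB (Fp L) (Fin N × Fin 1)),
      ∀ (Φinf : 𝓢(((Fin N × Fin 1) → mixedSpace (Fp L)), ℂ)) (f : FinSB (Fp L) (Fin N × Fin 1)),
        adelicMpCont.omega (Fp L) (Fin N × Fin 1) _ (rKron L dV hdV hdV0 dV' hdV' (lineW L (TW (Fp L) a)) (complexConj_lineW L (TW (Fp L) a)) (lineW_ne_zero L (TW (Fp L) a) (isUnit_det_TW (Fp L) a)) (coe_aOfB L B) (aOfB_isometry L dV dV' B hB) hCC₀ hC) (piSchwartzBruhatEquiv (Fp L) (Fin N × Fin 1) (Φinf ⊗ₜ f)) =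
          piSchwartzBruhatEquiv (Fp L) (Fin N × Fin 1) (A Φinf ⊗ₜ Q f) :=
    exists_omega_tmul_ratPointsThetaLiftCont_realDiagonal L dV hdV hdV0 (lineW L (TW (Fp L) a)) (complexConj_lineW L (TW (Fp L) a)) (lineW_ne_zero L (TW (Fp L) a) (isUnit_det_TW (Fp L) a)) _ _
  let R : piSchwartzBruhat (Fp L) (Fin n) →ₗ[ℂ] piSchwartzBruhat (Fp L) (Fin n') := (piSBReindex (Fp L) (e.symm.trans e₁)).toLinearMap ∘ₗ Re
  have hRapp : ∀ Φ, R Φ = piSBReindex (Fp L) (e.symm.trans e₁) (Re Φ) := fun _ => rfl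
  refine ⟨R, A, Q, fun Ψ => ?_, fun k u Φ => ?_, fun φ f => ?_⟩
  · rw [hRapp, thetaDistLM_piSBReindex, hΘe]
  · rw [hRapp, hRapp, hRe, hR₂]
  · rw [hRapp, hReapp, LinearEquiv.symm_apply_apply, hAQ, piSBReindex_symm_trans_piSBReindex]

end Operator

end Summit.HodgeConjecture.HodgeConjecture.Cruxes.H413.K2E2CapLineFrameTransportOperator

end
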